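import Mathlib.FieldTheory.IsAlgClosed.AlgebraicClosure
import Mathlib.FieldTheory.Galois.Basic
import Mathlib.RingTheory.Unramified.Locus
import Literature.NumberTheory.GaloisRepresentations.GaloisRep
import HarnessLib

/-!
# Decomposed generic residual Galois representations (Allen et al. 2023, Def. 4.3.1) and the subgroup `Γ_{K(ζ_ℓ)}`

Topic `NumberTheory/GaloisRepresentations`.  Two pieces of vocabulary for the residual
hypotheses of the automorphy lifting / potential automorphy theorems over CM fields (ACC+ =
Allen–Calegari–Caraiani–Gee–Helm–Le Hung–Newton–Scholze–Taylor–Thorne, *Potential automorphy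
over CM fields*, Ann. of Math. 197 (2023), Thm. 6.1.1–6.1.2; Qian, *Potential automorphy for
`GL_n`*, Invent. Math. 231 (2023), Thm. 1.4), requested by route `SelfDefeatingInduction`
(summit `Langlands`).

**Decomposed generic** (ACC+ Definition 4.3.1, as printed; `k` a finite field of
characteristic `p`): "Let `𝔭 ≠ p` be a prime, and let `L/ℚ_𝔭` be a finite extension. We say
that a continuous representation `r̄ : G_L → GL_n(k)` is *generic* if it is unramified and the
eigenvalues (with multiplicity) `α_1, …, α_n ∈ k̄` of `r̄(Frob_L)` satisfy
`α_i / α_j ∉ {1, |𝒪_L/𝔪_L|}` for all `i ≠ j`.  Let `L` be a number field, and let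
`r̄ : G_L → GL_n(k)` be a continuous representation. We say that a prime `𝔭 ≠ p` is *decomposed
generic for `r̄`* if `𝔭` splits completely in `L` and for all places `v | 𝔭` of `L`,
`r̄|_{G_{L_v}}` is generic.  … We say that `r̄` is *decomposed generic* if there exists a prime
`𝔭 ≠ p` which is decomposed generic for `r̄`."  (Then there are infinitely many, Lemma 4.3.2,
Chebotarev.)

## Main definitions

* `IsGenericAt τ v` — for a homomorphism `τ : Γ_K →* GL_n(k)` of the absolute Galois group of a
  number field `K` and a finite place `v`: `τ` is unramified at `v` (every inertia group
  `I_𝔓 ≤ Γ_K`, `𝔓 ∣ v`, is killed — the algebraic rendering of the tree's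
  `FramedGaloisRep.IsUnramifiedAt`) and for every (arithmetic) Frobenius `σ` at every `𝔓 ∣ v`
  the multiset of roots in `k̄` of the characteristic polynomial of `τ σ` (the `n` eigenvalues
  with multiplicity) has no repetition and contains no pair `a ≠ b` with `a = q_v b`
  (`q_v = v.residueCard`); i.e. `α_i/α_j ∉ {1, q_v}` for `i ≠ j`.  The global-at-`v` form of
  "`r̄|_{G_{L_v}}` is generic" (the decomposition group at `𝔓` is the image of `G_{L_v}`).
* `IsDecomposedGenericPrime τ p` — the rational prime `p` is decomposed generic for `τ`:
  `p` is prime, `p ≠ ringChar k`, `p` splits completely in `K` (unramified, Mathlib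
  `Algebra.IsUnramifiedIn (𝓞 K) (p)`, with every residue field over `p` of cardinality `p`),
  and `τ` is generic at every place over `p`.
* `IsDecomposedGeneric τ` — some rational prime is decomposed generic for `τ`.
* `absGaloisGroupAdjoinRootsOfUnity K ℓ` — the closed subgroup `Γ_{K(ζ_ℓ)} = Gal(K̄/K(μ_ℓ))` of
  `Γ_K` (Mathlib `IntermediateField.fixingSubgroup` of `K(μ_ℓ) = K({x ∈ K̄ | x^ℓ = 1})`), with
  `mem_absGaloisGroupAdjoinRootsOfUnity_iff : σ ∈ Γ_{K(ζ_ℓ)} ↔ ∀ x, x ^ ℓ = 1 → σ • x = x`; the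
  group on which "the image of `r̄|_{G_{F(ζ_l)}}` is enormous" and outside which a scalar
  `r̄(σ)` is required (ACC+ Thm. 6.1.1; Qian Thm. 1.4).

## Design

* Residual representations in the tree are bare homomorphisms `Γ_K →* GL_n(k)`
  (`IsResidualRepOf`, `FramedGaloisRep.residualRep`, file `ResidualGaloisRep`: topology plays
  no role), so the predicates are stated for `MonoidHom`s; a framed `ρ̄ : FramedGaloisRep K k n`
  enters through its coercion, and then the unramifiedness clause is literally
  `ρ̄.IsUnramifiedAt v` (`isGenericAt_coe_iff`).
* Frobenius convention: the tree's Frobenius elements are *arithmetic* (Mathlib `IsArithFrobAt`,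
  as in `FramedGaloisRep.HasFrobCharpolyAt`); ACC+ use geometric Frobenii.  The condition is
  insensitive to the choice: replacing every eigenvalue by its inverse replaces the set of
  ratios `{α_i/α_j : i ≠ j}` by itself.
* Eigenvalues "in `k̄`, with multiplicity" are the roots in `AlgebraicClosure k` of the
  characteristic polynomial (a monic polynomial of degree `n`, which splits there).
* "`p` splits completely in `K`" is rendered as: `K` is unramified above `p` and `q_v = p` for
  every `v ∣ p` (residue degree one) — equivalent to `e = f = 1` at all primes over `p`.
* NOT here: Lemma 4.3.2 (infinitely many decomposed generic primes; Chebotarev), stability under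
  restriction to extensions in which `p` splits, sufficient criteria — wanted API recorded on the
  definition item, each a separate (named) result.

## References

* [ACCGHLNSTT2023] P. Allen et al., *Potential automorphy over CM fields*, Ann. of Math. 197
  (2023), Def. 4.3.1, Lemma 4.3.2, Thm. 6.1.1–6.1.2 (held: arXiv:1812.09999, §4.3, §6.1).
* [Qian2022] L. Qian, *Potential automorphy for `GL_n`*, Invent. Math. 231 (2023), Thm. 1.4
  (held: arXiv:2104.09761, p. 2).
* A. Caraiani, P. Scholze, *On the generic part of the cohomology of compact unitary Shimura
  varieties*, Ann. of Math. 186 (2017), Def. 1.9 (the origin of "decomposed generic"; not held).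
-/

noncomputable section

open scoped MatrixGroups NumberField Polynomial
open Field IsDedekindDomain

namespace Literature.NumberTheory.GaloisRepresentations

universe u w

/-! ### Generic at a place, decomposed generic -/

section Generic

variable {K : Type u} [Field K] [NumberField K] {k : Type w} [Field k] {n : ℕ}

/-- The **eigenvalues with multiplicity** of `g ∈ GL_n(k)` in the algebraic closure `k̄`: the
roots in `k̄` of the characteristic polynomial of `g`. [folklore] -/
def eigenvalueMultiset (g : GL (Fin n) k) : Multiset (AlgebraicClosure k) :=
  ((((g : GL (Fin n) k) : Matrix (Fin n) (Fin n) k).charpoly).map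
    (algebraMap k (AlgebraicClosure k))).roots

/-- Unfolding lemma for `eigenvalueMultiset`. [folklore] -/
lemma eigenvalueMultiset_def (g : GL (Fin n) k) :
    eigenvalueMultiset g =
      ((((g : GL (Fin n) k) : Matrix (Fin n) (Fin n) k).charpoly).map
        (algebraMap k (AlgebraicClosure k))).roots :=
  rfl

/-- There are `n` eigenvalues with multiplicity (the characteristic polynomial is monic of
degree `n` and splits in `k̄`; Mathlib `IsAlgClosed.card_roots_eq_natDegree`,
`Matrix.charpoly_natDegree_eq_dim`). [folklore] -/
lemma card_eigenvalueMultiset (g : GL (Fin n) k) : Multiset.card (eigenvalueMultiset g) = n := by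
  rw [eigenvalueMultiset, IsAlgClosed.card_roots_eq_natDegree, Polynomial.natDegree_map,
    Matrix.charpoly_natDegree_eq_dim, Fintype.card_fin]

/-- **`τ : Γ_K →* GL_n(k)` is generic at the finite place `v`** (ACC+ Def. 4.3.1, first bullet,
for the decomposition groups at `v`): `τ` is unramified at `v` — every inertia group `I_𝔓 ≤ Γ_K`
at a prime `𝔓` of `\bar ℤ_K` over `v` is killed — and for every arithmetic Frobenius `σ` at
every such `𝔓` the eigenvalues `α_1, …, α_n ∈ k̄` of `τ σ` (with multiplicity,
`eigenvalueMultiset`) satisfy `α_i / α_j ∉ {1, q_v}` for all `i ≠ j`: they are pairwise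
distinct (`Multiset.Nodup`) and no two distinct ones `a ≠ b` have `a = q_v · b`
(`q_v = v.residueCard = |𝒪_K / v|`, cast into `k̄`).  The condition is the same for geometric
Frobenii (module docstring). [cite: ACCGHLNSTT2023, Def. 4.3.1] -/
def IsGenericAt (τ : absoluteGaloisGroup K →* GL (Fin n) k) (v : HeightOneSpectrum (𝓞 K)) :
    Prop :=
  (∀ 𝔓 ∈ v.primesAbove, ∀ σ ∈ 𝔓.inertia (absoluteGaloisGroup K), τ σ = 1) ∧
    ∀ 𝔓 ∈ v.primesAbove, ∀ σ : absoluteGaloisGroup K, IsArithFrobAt (𝓞 K) σ 𝔓 →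
      (eigenvalueMultiset (τ σ)).Nodup ∧
        ∀ a ∈ eigenvalueMultiset (τ σ), ∀ b ∈ eigenvalueMultiset (τ σ),
          a ≠ b → a ≠ (v.residueCard : AlgebraicClosure k) * b

/-- Unfolding lemma for `IsGenericAt`. [folklore] -/
lemma isGenericAt_iff (τ : absoluteGaloisGroup K →* GL (Fin n) k) (v : HeightOneSpectrum (𝓞 K)) :
    IsGenericAt τ v ↔
      (∀ 𝔓 ∈ v.primesAbove, ∀ σ ∈ 𝔓.inertia (absoluteGaloisGroup K), τ σ = 1) ∧
        ∀ 𝔓 ∈ v.primesAbove, ∀ σ : absoluteGaloisGroup K, IsArithFrobAt (𝓞 K) σ 𝔓 →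
          (eigenvalueMultiset (τ σ)).Nodup ∧
            ∀ a ∈ eigenvalueMultiset (τ σ), ∀ b ∈ eigenvalueMultiset (τ σ),
              a ≠ b → a ≠ (v.residueCard : AlgebraicClosure k) * b :=
  Iff.rfl

/-- For a framed (continuous) `ρ̄ : Γ_K →ₜ* GL_n(k)` the unramifiedness clause of `IsGenericAt`
for the underlying homomorphism is the tree's `FramedGaloisRep.IsUnramifiedAt`. [folklore] -/
lemma isGenericAt_coe_iff [TopologicalSpace k] (ρ : FramedGaloisRep K k n)
    (v : HeightOneSpectrum (𝓞 K)) :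
    IsGenericAt (ρ : absoluteGaloisGroup K →* GL (Fin n) k) v ↔
      ρ.IsUnramifiedAt v ∧
        ∀ 𝔓 ∈ v.primesAbove, ∀ σ : absoluteGaloisGroup K, IsArithFrobAt (𝓞 K) σ 𝔓 →
          (eigenvalueMultiset (ρ σ)).Nodup ∧
            ∀ a ∈ eigenvalueMultiset (ρ σ), ∀ b ∈ eigenvalueMultiset (ρ σ),
              a ≠ b → a ≠ (v.residueCard : AlgebraicClosure k) * b :=
  Iff.rfl

/-- A representation generic at `v` is unramified at `v` (first clause). [folklore] -/
lemma IsGenericAt.apply_eq_one {τ : absoluteGaloisGroup K →* GL (Fin n) k}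
    {v : HeightOneSpectrum (𝓞 K)} (h : IsGenericAt τ v)
    {𝔓 : Ideal (absIntegers (𝓞 K) K)} (h𝔓 : 𝔓 ∈ v.primesAbove)
    {σ : absoluteGaloisGroup K} (hσ : σ ∈ 𝔓.inertia (absoluteGaloisGroup K)) : τ σ = 1 :=
  h.1 𝔓 h𝔓 σ hσ

variable (K) in
/-- **The rational prime `p` splits completely in the number field `K`**: `K` is unramified
above `p` (Mathlib `Algebra.IsUnramifiedIn (𝓞 K) (p)`: every prime of `𝓞 K` over `(p)` is
unramified over `ℤ`) and every place `v ∣ p` has residue field of cardinality `p` (residue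
degree one), i.e. `e(v|p) = f(v|p) = 1` for all `v ∣ p`. [folklore] -/
def SplitsCompletely (p : ℕ) : Prop :=
  Algebra.IsUnramifiedIn (𝓞 K) (Ideal.span {(p : ℤ)}) ∧
    ∀ v : HeightOneSpectrum (𝓞 K), ((p : ℕ) : 𝓞 K) ∈ v.asIdeal → v.residueCard = p

/-- Unfolding lemma for `SplitsCompletely`. [folklore] -/
lemma splitsCompletely_iff (p : ℕ) :
    SplitsCompletely K p ↔
      Algebra.IsUnramifiedIn (𝓞 K) (Ideal.span {(p : ℤ)}) ∧
        ∀ v : HeightOneSpectrum (𝓞 K), ((p : ℕ) : 𝓞 K) ∈ v.asIdeal → v.residueCard = p :=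
  Iff.rfl

/-- **The rational prime `p` is decomposed generic for `τ : Γ_K →* GL_n(k)`** (ACC+ Def. 4.3.1,
second bullet): `p` is a prime different from the characteristic of `k` ("`𝔭 ≠ p`"), `p` splits
completely in `K`, and `τ` is generic at every place `v ∣ p` of `K`.
[cite: ACCGHLNSTT2023, Def. 4.3.1] -/
def IsDecomposedGenericPrime (τ : absoluteGaloisGroup K →* GL (Fin n) k) (p : ℕ) : Prop :=
  p.Prime ∧ p ≠ ringChar k ∧ SplitsCompletely K p ∧
    ∀ v : HeightOneSpectrum (𝓞 K), ((p : ℕ) : 𝓞 K) ∈ v.asIdeal → IsGenericAt τ v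

/-- **`τ : Γ_K →* GL_n(k)` is decomposed generic** (ACC+ Def. 4.3.1, third bullet): some
rational prime is decomposed generic for `τ`. [cite: ACCGHLNSTT2023, Def. 4.3.1] -/
def IsDecomposedGeneric (τ : absoluteGaloisGroup K →* GL (Fin n) k) : Prop :=
  ∃ p : ℕ, IsDecomposedGenericPrime τ p

/-- Unfolding lemma for `IsDecomposedGenericPrime`. [folklore] -/
lemma isDecomposedGenericPrime_iff (τ : absoluteGaloisGroup K →* GL (Fin n) k) (p : ℕ) :
    IsDecomposedGenericPrime τ p ↔
      p.Prime ∧ p ≠ ringChar k ∧ SplitsCompletely K p ∧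
        ∀ v : HeightOneSpectrum (𝓞 K), ((p : ℕ) : 𝓞 K) ∈ v.asIdeal → IsGenericAt τ v :=
  Iff.rfl

/-- Unfolding lemma for `IsDecomposedGeneric`. [folklore] -/
lemma isDecomposedGeneric_iff (τ : absoluteGaloisGroup K →* GL (Fin n) k) :
    IsDecomposedGeneric τ ↔ ∃ p : ℕ, IsDecomposedGenericPrime τ p :=
  Iff.rfl

/-- A decomposed generic prime witnesses decomposed genericity. [folklore] -/
lemma IsDecomposedGenericPrime.isDecomposedGeneric {τ : absoluteGaloisGroup K →* GL (Fin n) k}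
    {p : ℕ} (h : IsDecomposedGenericPrime τ p) : IsDecomposedGeneric τ :=
  ⟨p, h⟩

/-- A decomposed generic prime is a prime different from `char k`. [folklore] -/
lemma IsDecomposedGenericPrime.prime {τ : absoluteGaloisGroup K →* GL (Fin n) k} {p : ℕ}
    (h : IsDecomposedGenericPrime τ p) : p.Prime ∧ p ≠ ringChar k :=
  ⟨h.1, h.2.1⟩

end Generic

/-! ### The subgroup `Γ_{K(ζ_ℓ)}` -/

section Cyclotomic

variable (K : Type u) [Field K] (ℓ : ℕ)

/-- **`Γ_{K(ζ_ℓ)} = Gal(K̄/K(μ_ℓ))`** as a subgroup of `Γ_K = Gal(K̄/K)`: the automorphisms of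
`K̄` over `K` fixing the intermediate field `K(μ_ℓ)` generated by the `ℓ`-th roots of unity of
`K̄` (Mathlib `IntermediateField.fixingSubgroup`, `IntermediateField.adjoin`); equivalently those
fixing every `x ∈ K̄` with `x ^ ℓ = 1` (`mem_absGaloisGroupAdjoinRootsOfUnity_iff`).  For `ℓ`
prime to `char K` and `ζ_ℓ` a primitive `ℓ`-th root of unity, `K(μ_ℓ) = K(ζ_ℓ)`.
[cite: ACCGHLNSTT2023, Thm. 6.1.1 (hypothesis on `ρ̄|_{G_{F(ζ_p)}}`)] -/
def absGaloisGroupAdjoinRootsOfUnity : Subgroup (absoluteGaloisGroup K) :=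
  (IntermediateField.adjoin K {x : AlgebraicClosure K | x ^ ℓ = 1}).fixingSubgroup

variable {K ℓ}

/-- `σ ∈ Γ_{K(ζ_ℓ)}` iff `σ` fixes every `ℓ`-th root of unity of `K̄`. [folklore] -/
theorem mem_absGaloisGroupAdjoinRootsOfUnity_iff (σ : absoluteGaloisGroup K) :
    σ ∈ absGaloisGroupAdjoinRootsOfUnity K ℓ ↔
      ∀ x : AlgebraicClosure K, x ^ ℓ = 1 → σ • x = x := by
  constructor
  · intro h x hx
    rw [absoluteGaloisGroup.smul_def]
    exact (IntermediateField.mem_fixingSubgroup_iff _ (absoluteGaloisGroup.toAlgEquiv K σ)).1 h x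
      (IntermediateField.subset_adjoin K _ hx)
  · intro h
    -- work with the underlying `K`-algebra automorphism `σ'` of `K̄`
    set σ' : AlgebraicClosure K ≃ₐ[K] AlgebraicClosure K := absoluteGaloisGroup.toAlgEquiv K σ
      with hσ'
    have h' : ∀ x : AlgebraicClosure K, x ^ ℓ = 1 → σ' x = x := fun x hx => by
      rw [hσ', ← absoluteGaloisGroup.smul_def]; exact h x hx
    change σ' ∈ (IntermediateField.adjoin K {x : AlgebraicClosure K | x ^ ℓ = 1}).fixingSubgroup
    have hle : Subgroup.zpowers σ' ≤
        (IntermediateField.adjoin K {x : AlgebraicClosure K | x ^ ℓ = 1}).fixingSubgroup := by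
      rw [← IntermediateField.le_iff_le, IntermediateField.adjoin_le_iff]
      intro x hx
      simp only [SetLike.mem_coe, IntermediateField.mem_fixedField_iff]
      intro f hf
      have hst : Subgroup.zpowers σ' ≤
          MulAction.stabilizer (AlgebraicClosure K ≃ₐ[K] AlgebraicClosure K) x :=
        (Subgroup.zpowers_le (G := AlgebraicClosure K ≃ₐ[K] AlgebraicClosure K)).mpr
          ((MulAction.mem_stabilizer_iff).2 (h' x hx))
      exact (MulAction.mem_stabilizer_iff).1 (hst hf)
    exact hle (Subgroup.mem_zpowers σ')

/-- The identity lies in `Γ_{K(ζ_ℓ)}` (non-vacuity; it is a subgroup). [folklore] -/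
lemma one_mem_absGaloisGroupAdjoinRootsOfUnity : (1 : absoluteGaloisGroup K) ∈
    absGaloisGroupAdjoinRootsOfUnity K ℓ :=
  one_mem _

end Cyclotomic

end Literature.NumberTheory.GaloisRepresentations
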